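import Literature.Topology.PlanarFoliations.OmegaLimit
import Literature.Topology.PlanarFoliations.ClosedLeafCrossings
import HarnessLib

/-!
# Open leaves in the closure of an open union of compact leaves

Topic: Topology / PlanarFoliations, sequel to `JordanSack.lean`, `Monotone.lean`,
`OmegaLimit.lean`, `ClosedLeafCrossings.lean`. Let `F` be a bi-oriented foliation of a plane
domain `X ↪ ℂ` and `V ⊆ X` a **set all of whose points have compact leaves** (e.g. the open
set of points with image-null compact leaf of `BandOpen.lean`, a union of closed orbits). An
open (non-compact) leaf `L` contained in the **closure** of `V` — for instance a non-compact
leaf in the frontier of `V` — is very constrained: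

* `SackData.false_of_compact_leaf` (**proved**): **no compact leaf crosses the vertical segment
  of a sack strictly inside** — the compact leaf minus the crossing point is connected, misses
  the sack boundary (it meets the vertical only once, `compactLeaf_vert_subsingleton`, and is
  disjoint from `L`), yet has points on both sides of the segment near the crossing, which lie
  in different complementary components of the sack boundary (`rightSide_ne_leftSide`).
* `false_of_compact_leaf_between` (**proved**): the same between *any* two crossings `p < q` of
  `L` with the vertical, for a compact leaf crossing at a height strictly between theirs
  (induction on the intermediate crossings, as in `Monotone.lean`).
* `not_three_crossings` (**proved**): **`L` crosses each vertical of each flow box at most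
  twice** — of three crossings, one has height strictly inside the window of the other two
  (monotonicity of crossings), and near it there are points of `V`, whose compact leaves cross
  the vertical strictly inside that window.
* `not_mem_omegaSet_of_subset_closure` (**proved**): consequently **the ω-limit set of `L`
  contains no point of `X`** (an ω-limit point in `X` produces infinitely many crossings of the
  vertical through it): in a disc with finitely many singular points, both ends of such a leaf
  run into the singular set — the leaf is a *separatrix*. This is the structure of the frontier
  of the regions `Vᵢ` of closed null-homotopic orbits in Camacho–Lins Neto, *Geometric Theory
  of Foliations*, Ch. VII §2 Prop. 1 ("`∂Vᵢ` is either a closed orbit or a graph"), obtained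
  there from the Poincaré–Bendixson theorem.

All statements are [folklore] (Poincaré–Bendixson theory; Camacho–Lins Neto Ch. VI §4, VII §2).
-/

noncomputable section

open Set Filter Function
open _root_.Topology
open Literature.Topology.FourManifolds Literature.Topology.FourManifolds.Foliation
  Literature.Topology.FourManifolds.OneManifold Literature.Topology.PlaneTopology

namespace Literature.Topology.PlanarFoliations

variable {X : Type*} [TopologicalSpace X] [T2Space X] [SecondCountableTopology X] {F : Foliation ℝ X} {x : X}
variable [NoncompactSpace (F.Leaf x)] {hbi : IsBiOriented F}
variable {e : OpenPartialHomeomorph X (ℝ × ℝ)} {u₀ : ℝ} {ι : X → ℂ}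

/-! ## No compact leaf crosses the vertical segment of a sack -/

namespace SackData

variable (D : SackData hbi x e u₀)

/-- **No compact leaf crosses the vertical segment of a sack strictly between its end
heights.** [folklore] -/
theorem false_of_compact_leaf (he : e ∈ F.atlas) (hι : IsOpenEmbedding ι) {y : X}
    (hyC : IsCompact (F.leaf y)) (hdisj : Disjoint (F.leaf y) (F.leaf x)) {t₀ : ℝ}
    (ht₀ : t₀ ∈ Ioo D.tlo D.thi) (hy : e.symm (u₀, t₀) ∈ F.leaf y) : False := by
  have hιc := hι.continuous
  have hιi := hι.injective
  haveI : Nontrivial X := nontrivial_of_foliation F x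
  set z : X := e.symm (u₀, t₀) with hz
  -- the compact leaf minus the crossing point: connected, off the sack boundary
  set S : Set X := F.leaf y \ {z} with hS
  have hSconn : IsConnected S := isConnected_leaf_diff_singleton hbi hyC hy
  have hSdisj : Disjoint S D.traceX := by
    refine disjoint_left.2 fun w hw hwT ↦ ?_
    rcases hwT with ⟨s, hs, rfl⟩ | ⟨t, htI, rfl⟩
    · exact disjoint_left.1 hdisj hw.1 (D.g.symm s).2
    · have h := compactLeaf_vert_subsingleton hbi hι hyC he (hw.1 : e.symm (u₀, t) ∈ F.leaf y) hy
      exact hw.2 (by show e.symm (u₀, t) = z; rw [h])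
  have hSsub : ι '' S ⊆ (ι '' D.traceX)ᶜ := D.image_subset_compl hιi hSdisj
  have hSpre : IsPreconnected (ι '' S) := hSconn.isPreconnected.image _ hιc.continuousOn
  -- points of the compact leaf just right and just left of the crossing
  have hplaque : plaque e t₀ ⊆ F.leaf y := F.plaque_subset_leaf_of_mem he hy (symm_mem_plaque F he u₀ t₀)
  have hne : ∀ {u : ℝ}, u ≠ u₀ → e.symm (u, t₀) ∈ S := fun {u} hu ↦
    ⟨hplaque (symm_mem_plaque F he u t₀), fun h ↦ hu (by
      have h' := congrArg e (h : e.symm (u, t₀) = e.symm (u₀, t₀))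
      rw [e.right_inv (mk_mem_target F he u t₀), e.right_inv (mk_mem_target F he u₀ t₀)] at h'
      exact (Prod.ext_iff.1 h').1)⟩
  obtain ⟨δ₁, hδ₁, hR⟩ := D.eventually_mem_rightSide he hιc hιi ht₀
  obtain ⟨δ₂, hδ₂, hL⟩ := D.eventually_mem_leftSide he hιc hιi ht₀
  have hR' := hR (u₀ + δ₁ / 2) ⟨by linarith, by linarith⟩
  have hL' := hL (u₀ - δ₂ / 2) ⟨by linarith, by linarith⟩
  have hmemR : ι (e.symm (u₀ + δ₁ / 2, t₀)) ∈ ι '' S := mem_image_of_mem ι (hne (by linarith))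
  have hmemL : ι (e.symm (u₀ - δ₂ / 2, t₀)) ∈ ι '' S := mem_image_of_mem ι (hne (by linarith))
  -- both sides are the component of `ι '' S`
  have hsubR : ι '' S ⊆ D.rightSide he ι := by
    have h := hSpre.subset_connectedComponentIn hmemR hSsub
    rwa [← connectedComponentIn_eq hR'] at h
  have hsubL : ι '' S ⊆ D.leftSide he ι := by
    have h := hSpre.subset_connectedComponentIn hmemL hSsub
    rwa [← connectedComponentIn_eq hL'] at h
  refine D.rightSide_ne_leftSide he hι ?_
  show connectedComponentIn (ι '' D.traceX)ᶜ _ = connectedComponentIn (ι '' D.traceX)ᶜ _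
  rw [connectedComponentIn_eq (hsubR hmemR), connectedComponentIn_eq (hsubL hmemR)]

end SackData

/-! ## No compact leaf crosses between two crossings of an open leaf -/

/-- **No compact leaf crosses the vertical at a height strictly between the heights of two
crossings `p < q` of the open leaf** (with the compact leaf disjoint from the open leaf). By
induction on the number of crossings in `[p, q]` with intermediate heights: with none, this is
`SackData.false_of_compact_leaf`; otherwise split at such a crossing (its height differs from
that of the compact leaf's crossing, the two leaves being disjoint). [folklore] -/
theorem false_of_compact_leaf_between (he : e ∈ F.atlas) (hι : IsOpenEmbedding ι) {p q : F.Leaf x}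
    (hpq : leafLT hbi p q) (hp : IsCrossing e u₀ p) (hq : IsCrossing e u₀ q) {y : X}
    (hyC : IsCompact (F.leaf y)) (hdisj : Disjoint (F.leaf y) (F.leaf x)) {t₀ : ℝ}
    (ht₀ : t₀ ∈ Ioo (min (ht e p) (ht e q)) (max (ht e p) (ht e q))) (hy : e.symm (u₀, t₀) ∈ F.leaf y) : False := by
  -- the height of the compact leaf's crossing differs from the height of every crossing of `L`
  have hne : ∀ s : F.Leaf x, IsCrossing e u₀ s → ht e s ≠ t₀ := fun s hs h ↦ by
    refine disjoint_left.1 hdisj hy ?_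
    rw [← h, ← hs.pt_eq]
    exact s.2
  -- strong induction on the number of intermediate crossings
  suffices H : ∀ (n : ℕ) (p q : F.Leaf x), (finite_crossSet (hbi := hbi) (u₀ := u₀) he p q).toFinset.card ≤ n →
      leafLT hbi p q → IsCrossing e u₀ p → IsCrossing e u₀ q →
      t₀ ∉ Ioo (min (ht e p) (ht e q)) (max (ht e p) (ht e q)) from
    H _ p q le_rfl hpq hp hq ht₀
  intro n
  induction n with
  | zero =>
    intro p q hcard hpq hp _
    have hpmem : p ∈ (finite_crossSet (hbi := hbi) (u₀ := u₀) he p q).toFinset := by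
      rw [Set.Finite.mem_toFinset]
      exact ⟨left_mem_leafIcc (leafLT_asymm hpq), hp, left_mem_uIcc⟩
    have := Finset.card_pos.2 ⟨p, hpmem⟩
    omega
  | succ n ih =>
    intro p q hcard hpq hp hq hI
    by_cases hsucc : ∀ s, leafLT hbi p s → leafLT hbi s q → IsCrossing e u₀ s → ht e s ∉ uIcc (ht e q) (ht e p)
    · -- successive: the sack
      set D : SackData hbi x e u₀ := ⟨p, q, hpq, hp, hq, hsucc⟩ with hD
      exact D.false_of_compact_leaf he hι hyC hdisj hI hy
    · push Not at hsucc
      obtain ⟨s, hps, hsq, hs, hsI⟩ := hsucc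
      have hsp : ht e s ≠ ht e p := fun h ↦ leafLT_irrefl (hbi := hbi) p (by rwa [hs.eq_of_ht_eq hp h] at hps)
      have hsq' : ht e s ≠ ht e q := fun h ↦ leafLT_irrefl (hbi := hbi) q (by rwa [hs.eq_of_ht_eq hq h] at hsq)
      have hts : t₀ ≠ ht e s := (hne s hs).symm
      rw [uIcc_comm] at hsI
      -- the two sub-pairs have fewer intermediate crossings
      have hsub₁ : crossSet hbi e u₀ p s ⊆ crossSet hbi e u₀ p q := by
        rintro w ⟨⟨hw₁, hw₂⟩, hw, hwI⟩
        refine ⟨⟨hw₁, fun hqw ↦ hw₂ (leafLT_trans hsq hqw)⟩, hw, ?_⟩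
        exact uIcc_subset_uIcc left_mem_uIcc hsI hwI
      have hsub₂ : crossSet hbi e u₀ s q ⊆ crossSet hbi e u₀ p q := by
        rintro w ⟨⟨hw₁, hw₂⟩, hw, hwI⟩
        refine ⟨⟨fun hwp ↦ hw₁ (leafLT_trans hwp hps), hw₂⟩, hw, ?_⟩
        exact uIcc_subset_uIcc hsI right_mem_uIcc hwI
      have hq₁ : q ∈ crossSet hbi e u₀ p q ∧ q ∉ crossSet hbi e u₀ p s :=
        ⟨⟨right_mem_leafIcc (leafLT_asymm hpq), hq, right_mem_uIcc⟩, fun h ↦ h.1.2 hsq⟩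
      have hp₂ : p ∈ crossSet hbi e u₀ p q ∧ p ∉ crossSet hbi e u₀ s q :=
        ⟨⟨left_mem_leafIcc (leafLT_asymm hpq), hp, left_mem_uIcc⟩, fun h ↦ h.1.1 hps⟩
      have hcard₁ : (finite_crossSet (hbi := hbi) (u₀ := u₀) he p s).toFinset.card ≤ n := by
        have hss : (finite_crossSet (hbi := hbi) (u₀ := u₀) he p s).toFinset ⊂
            (finite_crossSet (hbi := hbi) (u₀ := u₀) he p q).toFinset := by
          rw [Set.Finite.toFinset_ssubset_toFinset]
          exact ⟨hsub₁, fun h ↦ hq₁.2 (h hq₁.1)⟩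
        have := Finset.card_lt_card hss
        omega
      have hcard₂ : (finite_crossSet (hbi := hbi) (u₀ := u₀) he s q).toFinset.card ≤ n := by
        have hss : (finite_crossSet (hbi := hbi) (u₀ := u₀) he s q).toFinset ⊂
            (finite_crossSet (hbi := hbi) (u₀ := u₀) he p q).toFinset := by
          rw [Set.Finite.toFinset_ssubset_toFinset]
          exact ⟨hsub₂, fun h ↦ hp₂.2 (h hp₂.1)⟩
        have := Finset.card_lt_card hss
        omega
      have ih₁ := ih p s hcard₁ hps hp hs
      have ih₂ := ih s q hcard₂ hsq hs hq
      -- position of `ht s` inside the window, and of `t₀` relative to `ht s`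
      have hsI' : min (ht e p) (ht e q) < ht e s ∧ ht e s < max (ht e p) (ht e q) := by
        rw [mem_uIcc] at hsI
        rcases hsI with ⟨h1, h2⟩ | ⟨h1, h2⟩
        · exact ⟨(min_le_left _ _).trans_lt (h1.lt_of_ne hsp.symm), (h2.lt_of_ne hsq').trans_le (le_max_right _ _)⟩
        · exact ⟨(min_le_right _ _).trans_lt (h1.lt_of_ne (Ne.symm hsq')), (h2.lt_of_ne hsp).trans_le (le_max_left _ _)⟩
      have hpqne : ht e p ≠ ht e q := fun h ↦ by
        have h' := hp.eq_of_ht_eq hq h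
        rw [h'] at hpq
        exact leafLT_irrefl q hpq
      rcases lt_or_gt_of_ne hpqne with hpq' | hqp'
      · rw [min_eq_left hpq'.le, max_eq_right hpq'.le] at hI hsI'
        rcases lt_or_gt_of_ne hts with hlt | hgt
        · apply ih₁
          rw [min_eq_left hsI'.1.le, max_eq_right hsI'.1.le]
          exact ⟨hI.1, hlt⟩
        · apply ih₂
          rw [min_eq_left hsI'.2.le, max_eq_right hsI'.2.le]
          exact ⟨hgt, hI.2⟩
      · rw [min_eq_right hqp'.le, max_eq_left hqp'.le] at hI hsI'
        rcases lt_or_gt_of_ne hts with hlt | hgt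
        · apply ih₂
          rw [min_eq_right hsI'.1.le, max_eq_left hsI'.1.le]
          exact ⟨hI.1, hlt⟩
        · apply ih₁
          rw [min_eq_right hsI'.2.le, max_eq_left hsI'.2.le]
          exact ⟨hgt, hI.2⟩

/-! ## An open leaf in the closure of an open union of compact leaves crosses each vertical at most twice -/

/-- **A compact leaf near a crossing inside a window**: if the open leaf lies in the closure of
an open set `V` all of whose leaves are compact, and `r` is a crossing whose height lies strictly
inside the window of two crossings `p < q`, then some compact leaf of `V` crosses the vertical
strictly inside that window — impossible by `false_of_compact_leaf_between`. [folklore] -/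
theorem false_of_crossing_in_window (he : e ∈ F.atlas) (hι : IsOpenEmbedding ι) {V : Set X}
    (hVc : ∀ v ∈ V, IsCompact (F.leaf v)) (hL : F.leaf x ⊆ closure V) {p q r : F.Leaf x}
    (hpq : leafLT hbi p q) (hp : IsCrossing e u₀ p) (hq : IsCrossing e u₀ q) (hr : IsCrossing e u₀ r)
    (hrI : ht e r ∈ Ioo (min (ht e p) (ht e q)) (max (ht e p) (ht e q))) : False := by
  -- a point of `V` near `pt r`, in the box, with height inside the window
  set N : Set X := e.source ∩ e ⁻¹' (univ ×ˢ Ioo (min (ht e p) (ht e q)) (max (ht e p) (ht e q))) with hN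
  have hNo : IsOpen N := e.isOpen_inter_preimage (isOpen_univ.prod isOpen_Ioo)
  have hrN : Leaf.pt r ∈ N := ⟨hr.1, mem_univ _, hrI⟩
  obtain ⟨v, ⟨hvs, -, hvt⟩, hvV⟩ := mem_closure_iff.1 (hL r.2) N hNo hrN
  -- its compact leaf crosses the vertical at the height of `v`
  have hcross : e.symm (u₀, (e v).2) ∈ F.leaf v :=
    F.plaque_subset_leaf_of_mem he (F.mem_leaf_self v) (mem_plaque_self hvs) (symm_mem_plaque F he u₀ _)
  -- the compact leaf is disjoint from the open leaf
  have hdisj : Disjoint (F.leaf v) (F.leaf x) := by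
    refine disjoint_left.2 fun w hwv hwx ↦ ?_
    have hEq : F.leaf x = F.leaf v := (F.leaf_eq_of_mem hwx).symm.trans (F.leaf_eq_of_mem hwv)
    have hK : IsCompact (F.leaf x) := hEq ▸ hVc v hvV
    haveI := compactSpace_leaf_of_isCompact hK
    exact not_compactSpace_iff.2 ‹NoncompactSpace (F.Leaf x)› inferInstance
  exact false_of_compact_leaf_between he hι hpq hp hq (hVc v hvV) hdisj hvt hcross

/-- Of three distinct reals with the third not strictly between the first two, either the second
is strictly between the first and the third, or the first is strictly between the second and the
third. [folklore] -/
theorem mem_Ioo_or_mem_Ioo_of_not_mem {a b c : ℝ} (hab : a ≠ b) (hbc : b ≠ c) (hac : a ≠ c)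
    (h : c ∉ Ioo (min a b) (max a b)) : b ∈ Ioo (min a c) (max a c) ∨ a ∈ Ioo (min b c) (max b c) := by
  rcases lt_trichotomy a b with hab' | hab' | hab'
  · rw [min_eq_left hab'.le, max_eq_right hab'.le] at h
    rcases lt_or_gt_of_ne hbc with hbc' | hbc'
    · left
      rw [min_eq_left (hab'.trans hbc').le, max_eq_right (hab'.trans hbc').le]
      exact ⟨hab', hbc'⟩
    · have hca : c < a := lt_of_le_of_ne (not_lt.1 fun h' ↦ h ⟨h', hbc'⟩) (Ne.symm hac)
      right
      rw [min_eq_right hbc'.le, max_eq_left hbc'.le]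
      exact ⟨hca, hab'⟩
  · exact absurd hab' hab
  · rw [min_eq_right hab'.le, max_eq_left hab'.le] at h
    rcases lt_or_gt_of_ne hbc with hbc' | hbc'
    · have hac' : a < c := lt_of_le_of_ne (not_lt.1 fun h' ↦ h ⟨hbc', h'⟩) hac
      right
      rw [min_eq_left hbc'.le, max_eq_right hbc'.le]
      exact ⟨hab', hac'⟩
    · left
      rw [min_eq_right (hbc'.trans hab').le, max_eq_left (hbc'.trans hab').le]
      exact ⟨hbc', hab'⟩

/-- **An open leaf in the closure of an open set of compact leaves crosses each vertical of each
flow box at most twice.** [folklore] -/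
theorem not_three_crossings (he : e ∈ F.atlas) (hι : IsOpenEmbedding ι) {V : Set X}
    (hVc : ∀ v ∈ V, IsCompact (F.leaf v)) (hL : F.leaf x ⊆ closure V) {p₁ p₂ p₃ : F.Leaf x}
    (h₁₂ : leafLT hbi p₁ p₂) (h₂₃ : leafLT hbi p₂ p₃) (hp₁ : IsCrossing e u₀ p₁) (hp₂ : IsCrossing e u₀ p₂)
    (hp₃ : IsCrossing e u₀ p₃) : False := by
  have h₁₃ : leafLT hbi p₁ p₃ := leafLT_trans h₁₂ h₂₃
  have hne : ∀ {p q : F.Leaf x}, leafLT hbi p q → IsCrossing e u₀ p → IsCrossing e u₀ q → ht e p ≠ ht e q :=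
    fun {p q} hlt hp hq h ↦ by
      have h' := hp.eq_of_ht_eq hq h
      rw [h'] at hlt
      exact leafLT_irrefl q hlt
  have hM := ht_not_mem_Ioo (hbi := hbi) he hι h₁₂ h₂₃ hp₁ hp₂ hp₃
  rcases mem_Ioo_or_mem_Ioo_of_not_mem (hne h₁₂ hp₁ hp₂) (hne h₂₃ hp₂ hp₃) (hne h₁₃ hp₁ hp₃) hM with h | h
  · exact false_of_crossing_in_window he hι hVc hL h₁₃ hp₁ hp₃ hp₂ h
  · exact false_of_crossing_in_window he hι hVc hL h₂₃ hp₂ hp₃ hp₁ h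

/-! ## The ω-limit set avoids the domain -/

/-- **The ω-limit set of an open leaf in the closure of an open set of compact leaves contains no
point of the domain**: such a point would be accumulated by crossings of the vertical through it,
three of which already contradict `not_three_crossings`. In a disc with finitely many singular
points the ends of such a leaf therefore run into the singular set: the leaf is a separatrix
(Camacho–Lins Neto, Ch. VII §2, Prop. 1: the frontier of a region of closed null-homotopic orbits
is a closed orbit or a graph). [folklore] -/
theorem not_mem_omegaSet_of_subset_closure (hι : IsOpenEmbedding ι) {V : Set X}
    (hVc : ∀ v ∈ V, IsCompact (F.leaf v)) (hL : F.leaf x ⊆ closure V) (z : X) :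
    ι z ∉ omegaSet hbi ι x := by
  intro hz
  obtain ⟨e, he, hze⟩ := F.exists_mem_source z
  have hz' : ι (e.symm ((e z).1, (e z).2)) ∈ omegaSet hbi ι x := by
    rw [Prod.mk.eta, e.left_inv hze]
    exact hz
  -- a crossing near `z`, then two more after it
  have hno : ∀ c : F.Leaf x, IsCrossing e (e z).1 c → ht e c ≠ (e z).2 := fun c hc h ↦ by
    have hpt : Leaf.pt c = z := by rw [hc.pt_eq, h, Prod.mk.eta, e.left_inv hze]
    have := not_mem_omegaSet_self hbi hι c
    rw [hpt] at this
    exact this hz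
  obtain ⟨c₁, hc₁, -⟩ := exists_crossing_near₀ (hbi := hbi) he hι hz' one_pos
  obtain ⟨c₂, h₁₂, hc₂, -⟩ := exists_crossing_near (hbi := hbi) he hι hz' hc₁ (hno c₁ hc₁)
    (abs_pos.2 (sub_ne_zero.2 (hno c₁ hc₁))) le_rfl
  obtain ⟨c₃, h₂₃, hc₃, -⟩ := exists_crossing_near (hbi := hbi) he hι hz' hc₂ (hno c₂ hc₂)
    (abs_pos.2 (sub_ne_zero.2 (hno c₂ hc₂))) le_rfl
  exact not_three_crossings he hι hVc hL h₁₂ h₂₃ hc₁ hc₂ hc₃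

end Literature.Topology.PlanarFoliations
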